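import Literature.AlgebraicGeometry.HodgeTheory.PencilStepBelowMiddleHolds
import HarnessLib

/-!
# `stub_pencilStepCodim` — THE PENCIL STEP BELOW THE MIDDLE DIMENSION, CODIMENSION-TRUNCATED

Registered stub `stub_pencilStepCodim` of line `Sketch` of crux `SummitGrantedFourfolds`
(stmt-HodgeConjecture-14600, route `NoetherLefschetzOneUp` of `HodgeConjecture`): de Cataldo–Migliorini
2009 §4, proof of Prop. 4.5 / Thomas 2005 §2, proof of Prop. 2 (case `k < d/2`), with its hypothesis
TRUNCATED to codimension `≤ p`. If on every smooth projective complex `m`-fold every rational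
`(q,q)`-class of codimension `q ≤ p` is algebraic, then on every smooth projective complex `(m+1)`-fold
`X` every rational `(p,p)`-class `c ∈ H²ᵖ(X(ℂ); ℂ)` with `2p ≤ m` lies in `algebraicClasses X p`.

PROOF (all inputs are theorems of the tree; no named fact, no `sorry`). Verbatim the tree's
`mem_algebraicClasses_of_two_mul_le_of_spread_supports` (`HodgeTheory/PencilStepBelowMiddleOfVerdier`),
whose hypothesis "the Hodge conjecture on smooth projective `m`-folds in ALL codimensions" is consulted
only in codimension `p` (on the smooth members of the pencil) and, through the strong-induction
hypothesis, in codimensions `< p` (descent of the generators `mem_algebraicClasses_of_pencil_spread`);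
fed with the DISCHARGED spreading of fibrewise supports `spread_supports_over_projectiveLine_holds`
(`HodgeTheory/SpreadSupportsOfSmoothFamily`). By strong induction on `p`:

1. a Lefschetz pencil `X̃ ⊆ X × ℙ¹ →π ℙ¹`, `σ : X̃ → X`, with `X̃` smooth and smooth members `X̃_t`
   off a proper closed `T` (`exists_goodPencil`); `c̃ = σ^* c`; the Hodge conjecture IN CODIMENSION `p`
   on the members makes `u_t^* c = ι_t^* c̃` algebraic (`u_t = ι_t ≫ σ : X̃_t → X`);
2. spreading of the fibrewise supports (`spread_supports_over_projectiveLine_holds`): a closed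
   `𝒵 ⊆ X̃` of codimension `≥ p` with `ι_t^* c̃` dying off `ι_t⁻¹ 𝒵` for `t` off a proper closed `S'`;
3. vertical support lines (`exists_verticalSupportLines`): off a proper closed `S₀`, every class of
   `H^{2p+2}(X̃)` dying off `𝒵 ∩ π⁻¹(t)` is `π^* η ∪ a` with `a` in the span of a fixed set `s` of
   rational algebraic classes of `X̃`; applied to `(ι_t)_* ι_t^* c̃ = κ_t c̃ ∪ π^* η` (projection
   formula, `exists_complexGysin_fiberι_one_eq_smul_map`) this gives `(κ_t c̃ − a_t) ∪ π^* η = 0`;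
4. descent of the generators (`mem_algebraicClasses_of_pencil_spread`, the inductive hypothesis in
   codimension `p − 1` on `X`): `ι_t^* a_t = u_t^* α`, `α ∈ N^p H^{2p}(X)`;
5. hard Lefschetz (`eq_zero_of_cupProduct_complexGysin_one_eq_zero`): `z = κ_t c − α` has
   `z ∪ (u_t)_* 1 = 0`, so `z = 0` and `c = κ_t⁻¹ α` is algebraic.

## References

* [DecataldoMigliorini2009] M. A. de Cataldo, L. Migliorini, On singularities of primitive cohomology
  classes, Proc. AMS 137 (2009), §4 Prop. 4.5 and its proof (arXiv:0711.1307v1 pp. 10–11).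
* [Thomas2005Nodes] R. P. Thomas, Nodes and the Hodge conjecture, J. Algebraic Geom. 14 (2005), §2
  Prop. 2 and its proof, case k < d/2 (p. 4).
* [VoisinHodgeII2003] C. Voisin, Hodge Theory and Complex Algebraic Geometry II (2003), §2.1.1,
  §3.3.1 and §10.2.1.
* [VoisinHodgeI2002] C. Voisin, Hodge Theory and Complex Algebraic Geometry I (2002), Thm. 6.25.
-/

-- `Summit.HodgeConjecture.HodgeConjecture.Theorems` is the mandated namespace (single-problem summit),
-- flagged by `linter.dupNamespace`; the lakefile turns the linter off tree-wide, restated here.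
set_option linter.dupNamespace false

noncomputable section

open scoped Manifold ContDiff
open CategoryTheory CategoryTheory.Limits AlgebraicGeometry MonoidalCategory CartesianMonoidalCategory
open Literature.AlgebraicTopology.SingularHomology
open Literature.AlgebraicGeometry.Motives
open Literature.AlgebraicGeometry.HodgeTheory

namespace Summit.HodgeConjecture.HodgeConjecture.Theorems

set_option maxHeartbeats 1600000 in
/-- **The pencil step below the middle dimension, codimension-truncated** — stub
`stub_pencilStepCodim` of line `Sketch` of crux `SummitGrantedFourfolds`. If on every smooth projective
complex `m`-fold every rational `(q,q)`-class of codimension `q ≤ p` is algebraic, then on every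
smooth projective complex `(m+1)`-fold `X` every rational `(p,p)`-class `c ∈ H²ᵖ(X(ℂ); ℂ)` with
`2p ≤ m` lies in `algebraicClasses X p`. Verbatim the tree's
`mem_algebraicClasses_of_two_mul_le_of_spread_supports` (Lefschetz pencil `exists_goodPencil`; the
Hodge conjecture on the smooth members IN CODIMENSION `p`; spreading of the fibrewise supports
`spread_supports_over_projectiveLine_holds`; vertical support lines `exists_verticalSupportLines`;
descent of the generators `mem_algebraicClasses_of_pencil_spread` by the inductive hypothesis IN
CODIMENSION `p - 1`; hard Lefschetz `eq_zero_of_cupProduct_complexGysin_one_eq_zero`), by strong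
induction on `p`: its hypothesis is consulted only in codimensions `≤ p`.
[cite: DecataldoMigliorini2009, §4 Prop. 4.5 and its proof (arXiv:0711.1307v1 pp. 10–11)]
[cite: Thomas2005Nodes, §2 Prop. 2 and its proof, case k < d/2] -/
theorem stub_pencilStepCodim :
    ∀ ⦃m : ℕ⦄ ⦃X : Literature.AlgebraicGeometry.Motives.SchemeOver ℂ⦄,
      Literature.AlgebraicGeometry.Motives.IsSmoothProjective (m + 1) X → ∀ (p : ℕ),
      (∀ ⦃Y : Literature.AlgebraicGeometry.Motives.SchemeOver ℂ⦄,
          Literature.AlgebraicGeometry.Motives.IsSmoothProjective m Y → ∀ q : ℕ, q ≤ p →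
          ∀ c : Literature.AlgebraicGeometry.HodgeTheory.complexBetti Y (2 * q),
            Literature.AlgebraicGeometry.HodgeTheory.IsRationalClass c →
            Literature.AlgebraicGeometry.HodgeTheory.IsOfHodgeType m Y (2 * q) q q c →
            c ∈ Literature.AlgebraicGeometry.HodgeTheory.algebraicClasses Y q) →
      2 * p ≤ m → ∀ c : Literature.AlgebraicGeometry.HodgeTheory.complexBetti X (2 * p),
        Literature.AlgebraicGeometry.HodgeTheory.IsRationalClass c →
        Literature.AlgebraicGeometry.HodgeTheory.IsOfHodgeType (m + 1) X (2 * p) p p c →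
        c ∈ Literature.AlgebraicGeometry.HodgeTheory.algebraicClasses X p := by
  intro m X hX p
  induction p using Nat.strong_induction_on with
  | _ p ih =>
  intro hHC hpm c hc hpp
  rcases p with _ | q
  · rw [algebraicClasses_zero]
    exact Submodule.mem_top
  -- players
  have hP : IsSmoothProjective 1 (projectiveSpace 1 ℂ) := isSmoothProjective_projectiveSpace' 1
  haveI : IrreducibleSpace (projectiveSpace 1 ℂ).left := hP.irreducibleSpace
  let μ : OrientationFamily := fun _ _ hZ ↦ (ComplexPoints.isOrientableOver ℂ hZ).some
  have hμ : μ.HasPoincareDuality := OrientationFamily.hasPoincareDuality μ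
  have hS := gysinMap_restrictCompl_eq_zero_of_field.{0, 0} ℂ
  -- the inductive hypothesis in codimension `q`: the truncated hypothesis restricts to `q' ≤ q`
  have hIH : ∀ c' : complexBetti X (2 * q), IsRationalClass c' → IsOfHodgeType (m + 1) X (2 * q) q q c' →
      c' ∈ algebraicClasses X q := fun c' hc'Q hc'H ↦
    ih q (lt_add_one q) (fun Y hY q' hq' c'' h1 h2 ↦ hHC hY q' (by omega) c'' h1 h2) (by omega)
      c' hc'Q hc'H
  -- (1) the pencil: `a ≠ 0`, `X̃` smooth projective of dimension `m + 1`, good members off `T`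
  obtain ⟨N, ι, hι⟩ := hX.isProjectiveOver
  haveI := hι
  obtain ⟨a, ha, hXt, T, hT, hTne, hfib⟩ := exists_goodPencil hX ι (by omega)
  haveI hsurj : Surjective (LinearSectionNet.proj ι a).left :=
    surjective_proj_left_of_goodPencil ι a hXt hT hTne hfib
  have hV : IsSmoothProjective (m + 1 + 1) (X ⊗ projectiveSpace 1 ℂ) := IsSmoothProjective.tensor_holds hX hP
  -- the Hodge conjecture on the members IN CODIMENSION `q + 1`, applied to `ι_s^* c̃`, `c̃ = σ^* c`
  set ct : complexBetti (LinearSectionNet.total ι a) (2 * (q + 1)) :=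
    complexBetti.map (LinearSectionNet.blowDown ι a) (2 * (q + 1)) c with hctdef
  have halg : ∀ s : ComplexPoints (projectiveSpace 1 ℂ), s.pt ∉ T →
      complexBetti.map (fiberι (LinearSectionNet.proj ι a) s) (2 * (q + 1)) ct ∈
        algebraicClasses (fiberOver (LinearSectionNet.proj ι a) s) (q + 1) := by
    intro s hs
    have hYs : IsSmoothProjective m (fiberOver (LinearSectionNet.proj ι a) s) := hfib s hs
    rw [hctdef, ← CategoryTheory.comp_apply, ← complexBetti.map_comp]
    exact hHC hYs (q + 1) le_rfl _ (hc.map _) (hpp.map_of_isSmoothProjective hYs hX _)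
  -- (2) spreading of the fibrewise supports (the discharged leaf (I))
  obtain ⟨𝒵, h𝒵, hc𝒵, S', hS', hTS', hS'ne, hdies⟩ :=
    spread_supports_over_projectiveLine_holds hXt (show 1 ≤ q + 1 by omega)
      (show q + 1 < m + 1 by omega) (LinearSectionNet.proj ι a) T hT hTne
      (fun s hs ↦ by rw [Nat.add_sub_cancel]; exact hfib s hs) ct halg
  -- (3) vertical support lines on `X̃`, for a generator `η` of `H²(ℙ¹)`
  obtain ⟨η, hη⟩ : ∃ η : complexBetti (projectiveSpace 1 ℂ) 2, η ≠ 0 := by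
    have h1 : Module.finrank ℂ (complexBetti (projectiveSpace 1 ℂ) 2) = 1 :=
      finrank_complexBetti_projectiveSpace_two_mul_eq_one 1 (p := 1) le_rfl
    haveI := Module.nontrivial_of_finrank_eq_succ h1
    exact exists_ne 0
  obtain ⟨e, he⟩ : ∃ e, q + 1 + e + 1 = m + 1 := ⟨m - (q + 1), by omega⟩
  have hXt' : IsSmoothProjective (q + 1 + e + 1) (LinearSectionNet.total ι a) := by rw [he]; exact hXt
  obtain ⟨S₀, hS₀, hS₀ne, s, hs, hlines⟩ :=
    exists_verticalSupportLines hXt' hP (LinearSectionNet.proj ι a) h𝒵 hc𝒵 hη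
  -- a good member: `t ∉ S' ∪ S₀`
  obtain ⟨t, ht⟩ := exists_complexPoint_pt_not_mem (hS'.union hS₀)
    (union_ne_univ_of_isClosed hS' hS'ne hS₀ hS₀ne)
  have htS' : t.pt ∉ S' := fun h ↦ ht (Or.inl h)
  have htS₀ : t.pt ∉ S₀ := fun h ↦ ht (Or.inr h)
  have hY : IsSmoothProjective m (fiberOver (LinearSectionNet.proj ι a) t) := hfib t fun h ↦ htS' (hTS' h)
  -- notation
  set φ := LinearSectionNet.proj ι a with hφdef
  set ιt := fiberι φ t with hιtdef
  set ut := fiberι φ t ≫ LinearSectionNet.blowDown ι a with hutdef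
  haveI : IsClosedImmersion ιt.left := isClosedImmersion_fiberι_proj_left ι a t
  have hab : 2 * (q + 1) + 2 * (m + 1) = 2 * (q + 1 + 1) + 2 * m := by ring
  have hab₀ : 0 + 2 * (m + 1) = 2 + 2 * m := by ring
  have h2 : 2 + 2 * (q + 1) = 2 * (q + 1 + 1) := by ring
  have h2' : 2 * (q + 1) + 2 = 2 * (q + 1 + 1) := by ring
  -- (3a) `(ι_t)_* (ι_t^* c̃)` dies off `𝒵 ∩ π⁻¹(t)`
  set xt : complexBetti (fiberOver φ t) (2 * (q + 1)) := complexBetti.map ιt (2 * (q + 1)) ct with hxtdef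
  have hpre : ιt.left.base ⁻¹' (𝒵 ∩ φ.left.base ⁻¹' {t.pt}) = ιt.left.base ⁻¹' 𝒵 := by
    ext z
    simp only [Set.mem_preimage, Set.mem_inter_iff, Set.mem_singleton_iff]
    exact ⟨fun h ↦ h.1, fun h ↦ ⟨h, apply_fiberι_base_eq_pt φ t z⟩⟩
  have hgdies : complexBetti.restrictCompl (LinearSectionNet.total ι a) (𝒵 ∩ φ.left.base ⁻¹' {t.pt})
      (2 * (q + 1 + 1)) (complexGysin μ hY hXt ιt hab xt) = 0 := by
    refine complexGysin_restrictCompl_eq_zero hS μ hμ hY hXt ιt hab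
      (h𝒵.inter (t.isClosed_pt.preimage φ.left.continuous)) xt ?_
    rw [hpre]
    exact hdies t htS'
  obtain ⟨at_, hat_, hF2⟩ := hlines t htS₀ _ hgdies
  -- (3b) the divisor line of the fibre: `(ι_t)_* 1 = κ • π^* η`, `κ ≠ 0`
  obtain ⟨κ, hκ⟩ := exists_complexGysin_fiberι_one_eq_smul_map μ hXt hP φ t hY hη
  have hκ0 : κ ≠ 0 := by
    rintro rfl
    rw [zero_smul] at hκ
    haveI := connectedSpace_complexPoints hY
    obtain ⟨P⟩ : Nonempty (ComplexPoints (fiberOver φ t)) := inferInstance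
    exact complexGysin_one_ne_zero_of_stalkMap_surjective μ hXt hY ιt P (ιt.left.stalkMap_surjective P.pt)
      (e := 1) (by omega) hκ
  -- (3c) projection formula for `ι_t`: `(ι_t)_* (ι_t^* b) = b ∪ (ι_t)_* 1 = κ • (π^* η ∪ b)`
  have hprojι : ∀ b : complexBetti (LinearSectionNet.total ι a) (2 * (q + 1)),
      complexGysin μ hY hXt ιt hab (complexBetti.map ιt (2 * (q + 1)) b) =
        κ • cupProduct h2 (complexBetti.map φ 2 η) b := fun b ↦ by
    have h3 := complexGysin_cup hμ hY hXt ιt (Nat.add_zero (2 * (q + 1))) hab hab₀ h2' b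
      (singularCohomology.one ℂ (ComplexPoints (fiberOver φ t)))
    rw [cupProduct_one] at h3
    rw [h3, hκ, map_smul, cupProduct_gradedComm_holds ℂ _ h2' h2 b, Even.neg_one_pow ⟨2 * (q + 1), by ring⟩,
      one_smul]
  -- hence `π^* η ∪ (κ • c̃ − a_t) = 0`
  have hkey : cupProduct h2 (complexBetti.map φ 2 η) (κ • ct - at_) = 0 := by
    rw [map_sub, map_smul, ← hprojι ct, ← hxtdef, hF2, sub_self]
  -- (4) descent of the generators: `ι_t^* a = u_t^* α` with `α` algebraic, for all `a ∈ span s`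
  have hgen : ∀ a' ∈ Submodule.span ℂ s, ∃ α ∈ algebraicClasses X (q + 1),
      complexBetti.map ιt (2 * (q + 1)) a' = complexBetti.map ut (2 * (q + 1)) α := by
    intro a' ha'
    induction ha' using Submodule.span_induction with
    | mem r hr =>
      obtain ⟨hrN, hrQ⟩ := hs r hr
      have hrH : IsOfHodgeType (m + 1) (LinearSectionNet.total ι a) (2 * (q + 1)) (q + 1) (q + 1) r :=
        isOfHodgeType_of_mem_algebraicClasses_of_isSmoothProjective hXt (q + 1) hrN
      -- weak Lefschetz for `emb : X̃ ⟶ X × ℙ¹`: `r = emb^* ζ`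
      have hAF1 := HypersurfaceSectionComplement.isZero_singularHomology_compl_range_hypersurfaceSectionι
        (R := ℂ) (M₀ := ℂ) hV
        (⟨_, Incidence.toSegre ι (𝟙 (projectiveSpace 1 ℂ)), isClosedImmersion_toSegre_id_left ι⟩ :
          ProjectiveEmbedding (X ⊗ projectiveSpace 1 ℂ))
        le_rfl (LinearSectionNet.incidenceForm a ((0 : Fin 2), (1 : Fin 2)))
        (LinearSectionNet.isHomogeneous_incidenceForm a _) (j := 2 * (m + 1 + 1) - 1 - 2 * (q + 1)) (by omega)
      rw [← range_map_emb_eq_range_map_hypersurfaceSectionι_pencil a ι] at hAF1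
      obtain ⟨ζ, hζ⟩ := surjective_complexBettiMap_of_isZero_singularHomology_compl_range hV hXt
        (LinearSectionNet.emb ι a) (j := 2 * (m + 1 + 1) - 1 - 2 * (q + 1)) (by omega) hAF1 r
      -- `α_r = s_t^* ζ`; `ι_t^* r = u_t^* α_r`
      have hres : complexBetti.map ιt (2 * (q + 1)) r =
          complexBetti.map ut (2 * (q + 1)) (complexBetti.map (sliceAt X t) (2 * (q + 1)) ζ) := by
        rw [← hζ, hιtdef, hutdef, ← CategoryTheory.comp_apply, ← complexBetti.map_comp,
          fiberι_emb_eq_sliceAt, ← CategoryTheory.comp_apply, ← complexBetti.map_comp]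
      refine ⟨_, ?_, hres⟩
      exact mem_algebraicClasses_of_pencil_spread hX ι ha hXt hpm hIH _ hrN hrQ hrH t hY hres
    | zero => exact ⟨0, Submodule.zero_mem _, by rw [map_zero, map_zero]⟩
    | add x y _ _ hx hy =>
      obtain ⟨α, hα, hxα⟩ := hx
      obtain ⟨β, hβ, hyβ⟩ := hy
      exact ⟨α + β, Submodule.add_mem _ hα hβ, by rw [map_add, map_add, hxα, hyβ]⟩
    | smul w x _ hx =>
      obtain ⟨α, hα, hxα⟩ := hx
      exact ⟨w • α, Submodule.smul_mem _ w hα, by rw [map_smul, map_smul, hxα]⟩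
  obtain ⟨α, hα, hια⟩ := hgen at_ hat_
  -- (5) hard Lefschetz: `z = κ • c − α` has `z ∪ (u_t)_* 1 = 0`
  set z : complexBetti X (2 * (q + 1)) := κ • c - α with hzdef
  have huz : complexBetti.map ut (2 * (q + 1)) z = complexBetti.map ιt (2 * (q + 1)) (κ • ct - at_) := by
    rw [hzdef, map_sub, map_smul, map_sub, map_smul, hια, hctdef, hutdef, complexBetti.map_comp,
      CategoryTheory.comp_apply]
  have hιy : complexGysin μ hY hXt ιt hab (complexBetti.map ιt (2 * (q + 1)) (κ • ct - at_)) = 0 := by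
    rw [hprojι, hkey, smul_zero]
  have huy : complexGysin μ hY hX ut hab (complexBetti.map ut (2 * (q + 1)) z) = 0 := by
    rw [huz, hutdef, complexGysin_comp hμ hY hXt hX (fiberι φ t) (LinearSectionNet.blowDown ι a) hab
      (show 2 * (q + 1 + 1) + 2 * (m + 1) = 2 * (q + 1 + 1) + 2 * (m + 1) from rfl), LinearMap.comp_apply,
      ← hιtdef, hιy, map_zero]
  have hcup : cupProduct h2' z (complexGysin μ hY hX ut hab₀
      (singularCohomology.one ℂ (ComplexPoints (fiberOver φ t)))) = 0 := by
    have h3 := complexGysin_cup hμ hY hX ut (Nat.add_zero (2 * (q + 1))) hab hab₀ h2' z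
      (singularCohomology.one ℂ (ComplexPoints (fiberOver φ t)))
    rw [cupProduct_one] at h3
    rw [← h3, huy]
  have hz0 : z = 0 :=
    eq_zero_of_cupProduct_complexGysin_one_eq_zero hX ι a t hY μ hpm hcup
  -- `c = κ⁻¹ • α`
  have hcα : c = κ⁻¹ • α := by
    have h1 : κ • c = α := sub_eq_zero.1 (by rw [← hzdef, hz0])
    rw [← h1, smul_smul, inv_mul_cancel₀ hκ0, one_smul]
  rw [hcα]
  exact Submodule.smul_mem _ _ hα

end Summit.HodgeConjecture.HodgeConjecture.Theorems

end
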